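/-
Copyright (c) 2026 the pub-hodgecm-mathlib formalisation cell (harness21).  Prover seat hodgecm-mathlib-LD1-p02 (g0), organ payer of half-A
line LD1 on loan to LD2 (organ C₂at′ `ArchSignAt₂'`, dealer LD2-plan (g0) 2026-09-02T03:17:52Z), hol-side kit, 2026-09-02.
THEOREMS ONLY (no definition, no named fact, no `sorry`, no instance, no notation).  `--supports stmt-HodgeConjecture-24832 --as helper`.
-/
import Summits.HodgeConjecture.HodgeConjecture.Theorems.F0LD2PinnedArchSingleTransport
import Literature.NumberTheory.Automorphic.Liu2021.ThetaLiftFromLineTorusCovariance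
import Literature.NumberTheory.Automorphic.UnitaryCurveCohCotangentForms
import HarnessLib

/-!
# The SCALED frame `ᵗ(c̄ g) · (t • H) · g = diag dV` read at one complex place `w`: the columns of `σ_w(g)` are a `σ_w(H)`-orthogonal frame with
# values `σ_w(dV p) / σ_w(t)`, `σ_w(H)` is hermitian when `σ_w(t)` is real, at rank 2 a negative and a positive column form a CONE FRAME, and the
# frame torus `σ_w(g) · diag(s) · σ_w(g)⁻¹` is diagonal on it and is carried by the PINNED transport to `(diag s at w; 1)`

Cell hodgecm-mathlib FLOOR 0, programme P6, half-A line LD (crux `hLiu418` = `stmt-HodgeConjecture-24832`), organ C₂at′ `ArchSignAt₂'` of the LD2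
skeleton of record v5 (sha16 e8da573259aec245 :325–:356).  Namespace `Summit.HodgeConjecture.HodgeConjecture.Cruxes.HLiu418.F0LD2ScaledFrameCone`.

* §1 (any rank) `conjTranspose_mul_map_mul_eq` — `σ(g)ᴴ · σ(H) · σ(g) = diagonal (σ(dV p) · σ(t)⁻¹)`; `star_col_dotProduct_mulVec_col` — the form values of the
  columns; `isHermitian_map_of_frame` — `σ(H)` is hermitian when `σ(t)` is real ([Jacobson, Ch. V §7]);
* §2 (any rank) `exists_archLocal_torus` — for unit `s` there is `γ ∈ U(σ_w H)(ℂ)` with `ιA (adelicSingle_H w γ) = adelicSingle_{diag dV} w u_s`, `↑u_s = diag s`,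
  and `γ · (σ(g) e_p) = s_p • σ(g) e_p` for every `p` (★ `exists_archLocal_coe_eq_diagonal` + ★ `F0LD2PinnedArchSingleTransport.exists_archLocal_pin_adelicSingle_eq`);
* §3 (rank 2) `exists_coneFrame_of_columns` — if `σ(dV p₋)·σ(t)⁻¹ < 0 < σ(dV p₊)·σ(t)⁻¹` then `(v₀, t₀) := (σ(g) e_{p₋}, σ(g) e_{p₊})` is a ★ `ConeFrame L H w`.

HONEST SCOPE.  Linear algebra and group bookkeeping; nothing of [Liu2021] is asserted.  HC_CM is proved only modulo the printed citations until rung 0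
closes; this file books nothing and discharges nothing booked.

## References
* [Jacobson] N. Jacobson, *Basic Algebra I*, Ch. V §7 pp. 150–151 (hermitian forms, orthogonal bases), §11 p. 162.
* [BorelJacquet1979] A. Borel, H. Jacquet, PSPM 33.1 (1979), §4.1.
* [Liu2021] Y. Liu, arXiv:2102.11518, App. D Lem. D.2 (3) (p. 127–128).
-/

set_option autoImplicit false
set_option linter.dupNamespace false

noncomputable section

open NumberField NumberField.InfinitePlace IsDedekindDomain Matrix
open scoped Matrix ComplexConjugate ComplexOrder

namespace Summit.HodgeConjecture.HodgeConjecture.Cruxes.HLiu418.F0LD2ScaledFrameCone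

open Literature.NumberTheory.Automorphic Literature.NumberTheory.Automorphic.UnitaryGroup
open Literature.NumberTheory.Automorphic.UnitaryCurveForms
open Literature.NumberTheory.Automorphic.Liu2021 Literature.NumberTheory.Automorphic.Liu2021.CinfThetaTorus
open Literature.AlgebraicGeometry.ShimuraVarieties
open Summit.HodgeConjecture.HodgeConjecture.Cruxes.HLiu418.F0LD2ArchAdmissibleAssembly (frame_smul_eq)
open Summit.HodgeConjecture.HodgeConjecture.Cruxes.HLiu418.F0LD2PinnedArchSingleTransport (exists_archLocal_pin_adelicSingle_eq)

/-! ## §1 The scaled frame at one complex place -/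

section Frame

variable (L : Type) [Field L] [NumberField L] [IsCMField L] (N : ℕ) (H : Matrix (Fin N) (Fin N) L) (dV : Fin N → L)
  (t : L) (ht : t ≠ 0) (g : GL (Fin N) L)
  (hg : formCongr ((IsCMField.complexConj L : L ≃ₐ[↥(maximalRealSubfield L)] L) : L →+* L) g (t • H) = Matrix.diagonal dV)
  (w : {w : InfinitePlace L // w.IsComplex})

/-- `σ((c̄ g)ᵀ) = σ(g)ᴴ` for a complex embedding `σ` of the CM field `L` (`σ ∘ c = conj ∘ σ`, ★ `embedding_cmConjRingHom`). [folklore] -/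
theorem map_transpose_map_cmConjRingHom (σ : L →+* ℂ) :
    (((g : Matrix (Fin N) (Fin N) L).map (cmConjRingHom L))ᵀ).map σ = ((g : Matrix (Fin N) (Fin N) L).map σ)ᴴ := by
  ext i j
  simp only [Matrix.map_apply, Matrix.transpose_apply, Matrix.conjTranspose_apply, embedding_cmConjRingHom, Complex.star_def]

include ht hg in
/-- **THE SCALED FRAME AT `w`**: `σ_w(g)ᴴ · σ_w(H) · σ_w(g) = diagonal (σ_w(dV p) · σ_w(t)⁻¹)` — apply `σ_w` to `ᵗ(c̄ g) · (t • H) · g = diag dV`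
(★ `frame_smul_eq`) and divide by `σ_w(t) ≠ 0`. [cite: Jacobson, Ch. V §7 pp. 150–151] -/
theorem conjTranspose_mul_map_mul_eq :
    ((g : Matrix (Fin N) (Fin N) L).map w.1.embedding)ᴴ * H.map w.1.embedding * (g : Matrix (Fin N) (Fin N) L).map w.1.embedding =
      Matrix.diagonal fun p => w.1.embedding (dV p) * (w.1.embedding t)⁻¹ := by
  have h0 := congrArg (fun M : Matrix (Fin N) (Fin N) L => M.map w.1.embedding) (frame_smul_eq L N H dV t g hg)
  simp only [Matrix.map_mul, Matrix.diagonal_map (map_zero _), map_transpose_map_cmConjRingHom] at h0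
  have hsm : (t • H).map (w.1.embedding : L →+* ℂ) = w.1.embedding t • H.map w.1.embedding := by
    ext i j
    simp only [Matrix.map_apply, Matrix.smul_apply, smul_eq_mul, map_mul]
  rw [hsm, Matrix.mul_smul, Matrix.smul_mul] at h0
  have hσt : w.1.embedding t ≠ 0 := (map_ne_zero _).2 ht
  have h1 := congrArg (fun M : Matrix (Fin N) (Fin N) ℂ => (w.1.embedding t)⁻¹ • M) h0
  simp only [smul_smul, inv_mul_cancel₀ hσt, one_smul] at h1
  rw [h1]
  ext i j
  rw [Matrix.smul_apply, Matrix.diagonal_apply, Matrix.diagonal_apply]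
  split_ifs <;> simp [mul_comm]

omit [NumberField L] [IsCMField L] in
/-- **Form values of columns**: `(σ(g) e_p)ᴴ · M · (σ(g) e_q) = (σ(g)ᴴ · M · σ(g))_{p q}`. [folklore] -/
theorem star_col_dotProduct_mulVec_col (A M : Matrix (Fin N) (Fin N) ℂ) (p q : Fin N) :
    star (A.col p) ⬝ᵥ (M *ᵥ A.col q) = (Aᴴ * M * A) p q := by
  simp only [dotProduct, Matrix.mulVec, Matrix.mul_apply, Matrix.conjTranspose_apply, Matrix.col_apply, Pi.star_apply, Finset.sum_mul,
    Finset.mul_sum]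
  rw [Finset.sum_comm]
  refine Finset.sum_congr rfl fun i _ => Finset.sum_congr rfl fun j _ => ?_
  ring

include ht hg in
/-- **`σ_w(H)` IS HERMITIAN WHEN `σ_w(t)` IS REAL**: `σ(H) = (σ(g)⁻¹)ᴴ · diagonal (σ(dV p) · σ(t)⁻¹) · σ(g)⁻¹` with a REAL diagonal (`dV p ∈ L⁺` since
`diag dV = ᵗ(c̄ g)(t•H)g` forces nothing on its own — realness of `σ(dV p)` is the hypothesis `hdV`). [cite: Jacobson, Ch. V §7 pp. 150–151] -/
theorem isHermitian_map_of_frame (hdV : ∀ i, IsCMField.complexConj L (dV i) = dV i) (hσt : (w.1.embedding t).im = 0) :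
    (H.map w.1.embedding).IsHermitian := by
  set A : Matrix (Fin N) (Fin N) ℂ := (g : Matrix (Fin N) (Fin N) L).map w.1.embedding with hA
  have hframe := conjTranspose_mul_map_mul_eq L N H dV t ht g hg w
  rw [← hA] at hframe
  -- `A` is invertible
  have hAA : A * ((g⁻¹ : GL (Fin N) L) : Matrix (Fin N) (Fin N) L).map w.1.embedding = 1 := by
    rw [hA, ← Matrix.map_mul, ← Units.val_mul, mul_inv_cancel, Units.val_one, Matrix.map_one _ (map_zero _) (map_one _)]
  set B : Matrix (Fin N) (Fin N) ℂ := ((g⁻¹ : GL (Fin N) L) : Matrix (Fin N) (Fin N) L).map w.1.embedding with hB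
  -- the real diagonal is hermitian
  have hD : (Matrix.diagonal fun p => w.1.embedding (dV p) * (w.1.embedding t)⁻¹).IsHermitian := by
    refine Matrix.isHermitian_diagonal_of_self_adjoint _ (funext fun p => ?_)
    have hreal : ∀ z : ℂ, z.im = 0 → star z = z := fun z hz => by
      rw [Complex.star_def]; exact Complex.conj_eq_iff_im.2 hz
    have hdVp : (w.1.embedding (dV p)).im = 0 := by
      have h1 : w.1.embedding (cmConjRingHom L (dV p)) = starRingEnd ℂ (w.1.embedding (dV p)) := embedding_cmConjRingHom L _ (dV p)
      have h2 : cmConjRingHom L (dV p) = dV p := hdV p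
      rw [h2] at h1
      exact Complex.conj_eq_iff_im.1 h1.symm
    rw [Pi.star_apply, star_mul, star_inv₀, hreal _ hσt, hreal _ hdVp, mul_comm]
  have hH : H.map w.1.embedding = Bᴴ * (Matrix.diagonal fun p => w.1.embedding (dV p) * (w.1.embedding t)⁻¹) * B := by
    rw [← hframe]
    calc H.map w.1.embedding = (A * B)ᴴ * H.map w.1.embedding * (A * B) := by
          rw [hAA, Matrix.conjTranspose_one, Matrix.one_mul, Matrix.mul_one]
      _ = Bᴴ * (Aᴴ * H.map w.1.embedding * A) * B := by simp only [Matrix.conjTranspose_mul, Matrix.mul_assoc]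
  rw [hH]
  exact Matrix.isHermitian_conjTranspose_mul_mul B hD

end Frame

/-! ## §2 The frame torus and its pinned transport -/

section Torus

variable (L : Type) [Field L] [NumberField L] [IsCMField L] (N : ℕ) (H : Matrix (Fin N) (Fin N) L) (dV : Fin N → L)
  (t : L) (ht : t ≠ 0) (g : GL (Fin N) L)
  (hg : formCongr ((IsCMField.complexConj L : L ≃ₐ[↥(maximalRealSubfield L)] L) : L →+* L) g (t • H) = Matrix.diagonal dV)
  (ιA : (adelicGroupData (↥(maximalRealSubfield L)) L (IsCMField.complexConj L) N H).Adelic →*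
    ↥(UnitaryGroup.adelic (↥(maximalRealSubfield L)) L (IsCMField.complexConj L) N (Matrix.diagonal dV)))
  (hιA : ∀ k, ((ιA k : ↥(UnitaryGroup.adelic (↥(maximalRealSubfield L)) L (IsCMField.complexConj L) N (Matrix.diagonal dV))) :
      GL (Fin N) (AdeleRing (𝓞 L) L)) =
    (toAdeleGL L g)⁻¹ * adelicVal (↥(maximalRealSubfield L)) L (IsCMField.complexConj L) N H k * toAdeleGL L g)
  (w : {w : InfinitePlace L // w.IsComplex})

include ht hg hιA in
/-- **THE FRAME TORUS THROUGH THE PINNED TRANSPORT.**  For unit `s : Fin N → ℂ` there are `u_s ∈ U(σ_w diag dV)(ℂ)` with matrix `diag s` and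
`γ ∈ U(σ_w H)(ℂ)` with `ιA (adelicSingle_H w γ) = adelicSingle_{diag dV} w u_s` and `γ (σ_w(g) e_p) = s_p • σ_w(g) e_p` for every `p`
(`γ = σ_w(g) · diag s · σ_w(g)⁻¹`; ★ `exists_archLocal_coe_eq_diagonal`, ★ `exists_archLocal_pin_adelicSingle_eq`). [cite: BorelJacquet1979, §4.1]
[cite: KonnoKonno2007, §3.1 (3.1)] -/
theorem exists_archLocal_torus (s : Fin N → ℂ) (hs : ∀ p, star (s p) * s p = 1) :
    ∃ (u : UnitaryGroup.archLocal L N (Matrix.diagonal dV) w) (γ : UnitaryGroup.archLocal L N H w),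
      (((u : UnitaryGroup.archLocal L N (Matrix.diagonal dV) w) : GL (Fin N) ℂ) : Matrix (Fin N) (Fin N) ℂ) = Matrix.diagonal s ∧
      ιA (UnitaryGroup.adelicSingle (↥(maximalRealSubfield L)) L (IsCMField.complexConj L) N H (IsCMField.complexConj_ne_one L)
          (complexConj_smul_infinitePlace L) w γ) =
        UnitaryGroup.adelicSingle (↥(maximalRealSubfield L)) L (IsCMField.complexConj L) N (Matrix.diagonal dV) (IsCMField.complexConj_ne_one L)
          (complexConj_smul_infinitePlace L) w u ∧
      ∀ p : Fin N, ((γ : GL (Fin N) ℂ) : Matrix (Fin N) (Fin N) ℂ) *ᵥ ((g : Matrix (Fin N) (Fin N) L).map w.1.embedding).col p =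
        s p • ((g : Matrix (Fin N) (Fin N) L).map w.1.embedding).col p := by
  obtain ⟨u, hu⟩ := exists_archLocal_coe_eq_diagonal L dV w s hs
  obtain ⟨γ, hγ, hmat⟩ := exists_archLocal_pin_adelicSingle_eq L N H dV t ht g hg ιA hιA w u
  refine ⟨u, γ, hu, hγ, fun p => ?_⟩
  have hG : ((Matrix.GeneralLinearGroup.map w.1.embedding g : GL (Fin N) ℂ) : Matrix (Fin N) (Fin N) ℂ) =
      (g : Matrix (Fin N) (Fin N) L).map w.1.embedding := rfl
  have hinv : (((Matrix.GeneralLinearGroup.map w.1.embedding g)⁻¹ : GL (Fin N) ℂ) : Matrix (Fin N) (Fin N) ℂ) *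
      (g : Matrix (Fin N) (Fin N) L).map w.1.embedding = 1 := by
    rw [← hG, ← Units.val_mul, inv_mul_cancel, Units.val_one]
  rw [hmat, Units.val_mul, Units.val_mul, hG, hu, ← Matrix.mulVec_single_one, Matrix.mulVec_mulVec, Matrix.mul_assoc, hinv, Matrix.mul_one,
    ← Matrix.mulVec_mulVec, Matrix.diagonal_mulVec_single, mul_one]
  ext i
  simp [Matrix.mulVec_single, mul_comm]

end Torus

/-! ## §3 Rank 2: a negative and a positive column form a cone frame -/

section Cone

variable (L : Type) [Field L] [NumberField L] [IsCMField L] (H : Matrix (Fin 2) (Fin 2) L) (dV : Fin 2 → L)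
  (t : L) (ht : t ≠ 0) (g : GL (Fin 2) L)
  (hg : formCongr ((IsCMField.complexConj L : L ≃ₐ[↥(maximalRealSubfield L)] L) : L →+* L) g (t • H) = Matrix.diagonal dV)
  (w : {w : InfinitePlace L // w.IsComplex})

include ht hg in
/-- **THE CONE FRAME OF THE SCALED FRAME'S COLUMNS** (rank 2).  If the column `p₋` of `σ_w(g)` is NEGATIVE for `σ_w(H)` and the column `p₊` is
POSITIVE — `(σ_w(dV p₋) σ_w(t)⁻¹).re < 0 < (σ_w(dV p₊) σ_w(t)⁻¹).re` — then `(v₀, t₀) := (σ_w(g) e_{p₋}, σ_w(g) e_{p₊})` is a cone frame of `H` at `w`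
(★ `ConeFrame`: `v₀ ∈ negCone σ_w(H)`, `0 < re ⟪t₀,t₀⟫`, `⟪t₀,v₀⟫ = 0`), by §1. [cite: BergeronMillsonMoeglin2016Balls, Part 2 §1.3]
[cite: Jacobson, Ch. V §7 pp. 150–151] -/
theorem exists_coneFrame_of_columns (pm pp : Fin 2) (hne : pp ≠ pm)
    (hm : (w.1.embedding (dV pm) * (w.1.embedding t)⁻¹).re < 0) (hp : 0 < (w.1.embedding (dV pp) * (w.1.embedding t)⁻¹).re) :
    ∃ 𝔣 : ConeFrame L H w,
      𝔣.v₀ = ((g : Matrix (Fin 2) (Fin 2) L).map w.1.embedding).col pm ∧ 𝔣.t₀ = ((g : Matrix (Fin 2) (Fin 2) L).map w.1.embedding).col pp := by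
  have hframe := conjTranspose_mul_map_mul_eq L 2 H dV t ht g hg w
  have hval : ∀ p q : Fin 2, star (((g : Matrix (Fin 2) (Fin 2) L).map w.1.embedding).col p) ⬝ᵥ
      (H.map w.1.embedding *ᵥ ((g : Matrix (Fin 2) (Fin 2) L).map w.1.embedding).col q) =
      (Matrix.diagonal fun p => w.1.embedding (dV p) * (w.1.embedding t)⁻¹) p q := fun p q => by
    rw [star_col_dotProduct_mulVec_col, hframe]
  refine ⟨⟨((g : Matrix (Fin 2) (Fin 2) L).map w.1.embedding).col pm, ((g : Matrix (Fin 2) (Fin 2) L).map w.1.embedding).col pp, ?_, ?_, ?_⟩,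
    rfl, rfl⟩
  · rw [mem_negCone_iff, hval, Matrix.diagonal_apply_eq]; exact hm
  · rw [hval, Matrix.diagonal_apply_eq]; exact hp
  · rw [hval, Matrix.diagonal_apply_ne _ hne]

end Cone

end Summit.HodgeConjecture.HodgeConjecture.Cruxes.HLiu418.F0LD2ScaledFrameCone

end
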